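import Literature.Analysis.FluidPDE.RadialCalculus
import Literature.Analysis.FluidPDE.WholeSpaceIBP
import Literature.Analysis.FluidPDE.VorticityStretching
import Mathlib.Analysis.SpecialFunctions.Pow.Deriv
import Mathlib.Analysis.SpecialFunctions.Pow.Continuity
import Mathlib.MeasureTheory.Measure.Haar.NormedSpace
import Mathlib.Analysis.SpecialFunctions.JapaneseBracket
import Mathlib.Analysis.SpecialFunctions.Pow.Asymptotics
import HarnessLib

/-!
# The Galdi–Gazzola bubble vortex: an explicit divergence-free field with a "magic cancellation"
# in `(V·∇)V`, exact power laws of its norms, and its (lack of) time regularity at the blow-up time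

Analysis/FluidPDE proofs-layer file (data definitions + theorems, NO new `Prop` facts) over the tree's
`convect` / `VectorCalculus.divergence` / `frobeniusNormSq` / `VectorCalculus.gradNormSq`
(`VectorCalculus.lean`), the radial calculus of `RadialCalculus.lean` (`hasFDerivAt_comp_norm_sq`), the
coordinate trace `trace_eq_sum_coord` (`VorticityStretching.lean`) and the Laplacian-as-sum-of-second-partials
`laplacian_eq_sum_fderiv_fderiv` (`WholeSpaceIBP.lean`); Mathlib's `Measure.integral_comp_inv_smul_of_nonneg`
for the scaling of integrals.

**Galdi–Gazzola 2026** (arXiv:2606.15189), §3: for `T > 0` and parameters `δ, γ > 0` the vector field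
`V(ξ,t) = (T−t)^{2δ} (2yz, −xz, −xy) / [(T−t)^{2γ} + |ξ|²]^{5/2}` on `ℝ³ × [0,T)` ((scelta), §3.1, p. 9; the
case `ℓ = 5` of (sceltaconl), p. 8) is the PRESCRIBED velocity of their forced blow-up examples
(Thms. 4.1, 4.5, 4.9–4.11, 4.15: the force `f := V_t − ΔV + (V·∇)V + ∇P` is computed a posteriori and fails,
exactly at `t = T`, the integrability under which no blow-up can occur). This file formalises the ALGEBRA of
that field, i.e. the part of §3 that is identities:

* `∇·V = 0` (§3.1, p. 8: "satisfies `∇·V = 0` in `ℝ³×[0,T)`") — `isDivFree_bubble`, `isDivFree_vortex`;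
* the **magic cancellation** (Lemma 3.4 and Remark 3.5, pp. 8–9; explicit form §3.2, p. 10):
  `(V·∇)V(ξ,t) = (T−t)^{4δ} (−2x(y²+z²), y(x²−2z²), z(x²−2y²)) / [(T−t)^{2γ}+|ξ|²]^5` — denominator power
  `ℓ = 5`, not `ℓ + 1 = 6`, BECAUSE `⟨ξ, W(ξ)⟩ = 0` for `W = (2yz, −xz, −xy)` (the radial-derivative term of
  the product rule drops out; Remark 3.9: without it the parameter triangles `A`, `B` are empty) —
  `inner_self_dir`, `convect_bubble`, `convect_vortex`;
* `ΔV` is again a multiple of `W` (proof of Lemma 3.4, p. 8: the `𝒫₄`-term carries the factor `(ℓ − 5)`,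
  which vanishes for `ℓ = 5`): `ΔV = −35 (T−t)^{2δ+2γ} W / [(T−t)^{2γ}+|ξ|²]^{9/2}` — `laplacian_bubble`,
  `laplacian_vortex` (the constant `−35` is ours; the source prints `𝒫₂`);
* `V_t` (proof of Lemma 3.4 / (Vt), pp. 8, 10) — `hasDerivAt_vortex` (constants ours);
* the **exact power laws** behind Lemma 3.7 (p. 9): `‖V(t)‖_q^q = C_q (T−t)^{2qδ+(3−3q)γ}` ((VLqq) with
  `ℓ = 5`; `q = 2`: `4δ−3γ`, `q = 3`: `6δ−6γ`) and `‖∇V(t)‖₂² = C (T−t)^{4δ−5γ}` ((nablaV2)) —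
  `integral_norm_rpow_vortex`, `integral_norm_sq_vortex`, `integral_norm_cube_vortex`, `gradNormSq_vortex`.
  Here the laws are proved by SELF-SIMILARITY (`bubble_sq`: `V_{R²,c}(ξ) = (c/R³) V_{1,1}(ξ/R)`) and the
  scaling of Haar measure, with the constants IDENTIFIED as the corresponding norms of the unit profile
  `V_{1,1} = bubble 1 1`; the radial integral of Lemma 3.1 (p. 8) is replaced by DOMINATION: the enstrophy
  density of `V_{1,1}` is `≤ 588 (1+|ξ|²)^{-4}` and `|V_{1,1}|³ ≤ 8 (1+|ξ|²)^{-9/2}`, so both constants are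
  finite (`integrable_frobeniusNormSq_fderiv_bubble_one`, `integrable_norm_bubble_one_cube`) and positive
  (`gradNormSq_bubble_one_pos`, `integral_norm_bubble_one_cube_pos`), and **Lemma 3.7** becomes a theorem:
  `‖∇V(t)‖₂² → ∞` (`t → T`) **iff** `4δ < 5γ` (`tendsto_gradNormSq_vortex_atTop_iff`, (blupenstrophy)) and
  `‖V(t)‖₃³ → ∞` **iff** `δ < γ` (`tendsto_integral_norm_cube_vortex_atTop_iff`, (blupL3));
* smoothness: `V ∈ C^∞` jointly on `(ℝ ∖ {T}) × ℝ³` and in space at every `t ≠ T`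
  (`contDiffOn_uncurry_vortex`, `contDiff_vortex`), `V(·,T) ≡ 0` (`vortex_blowupTime`; proof of Thm. 4.1,
  p. 12: "`V(ξ,T) = 0` in `ℝ³ ∖ {0}`").

**Erratum recorded by the kernel** (`not_differentiableAt_vortex_blowupTime`). Thm. 4.1 (p. 12) ends with
"such solution satisfies `V, P ∈ C^∞(ℝ³×ℝ₊ ∖ {(0,T)})`", the field being extended past `T` "with `(T−t)`
replaced by `|T−t|`". For `0 < 2δ < 1` — which contains the whole triangles `A` (Thm. 4.1) and `B` (Thm. 4.5),
both inside `1/3 < δ < 1/2` — the map `t ↦ V(ξ,t) = |T−t|^{2δ}(…)W(ξ)` is NOT differentiable at `t = T` at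
any `ξ` with `W(ξ) ≠ 0`: the extended field is `C^∞` on `ℝ³ × (ℝ₊ ∖ {T})` and continuous, but only Hölder of
order `2δ` in time across the hyperplane `t = T` (consistently with (VVV), p. 16: `V_t ∈ L^∞` iff
`γ ≤ (2δ−1)/3`, impossible for `δ < 1/2`). The blow-up statements of Thm. 4.1 (enstrophy / `L³` blow-up at the
single instant `T`, Def. 2.6) are not affected.

## What is NOT here (not NS-blow-up evidence)

No pressure `P = (−Δ)⁻¹∇·((V·∇)V)`, no force `f`, no Leray–Hopf theory, no `L^r(0,T;L^q)` classification of
`V_t, ΔV, (V·∇)V, f` (Lemmas 3.1, 3.4, 3.6, 3.8, the triangles `A`, `B`, `D`) — the exact evaluation of the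
radial integrals of Lemma 3.1 for general `(α, k, p, q)` is the analytic content of the paper; only the two
blow-up criteria of Lemma 3.7 are carried to the end here. The velocity here is PRESCRIBED; in every blow-up
theorem of the source the force fails at `t = T` exactly the class (`L²_t L²_x`, Sohr, *The Navier–Stokes
equations*, Thm. V.1.8.1 = GG Prop. 2.9) in which a Leray–Hopf solution with a Serrin-class velocity cannot
lose its enstrophy; a Clay (C)/(D) force is smooth. 2D twin: Gazzola 2026 (arXiv:2608.18802).

## References

* G. P. Galdi, F. Gazzola, *Blow-up and uniqueness of Leray–Hopf solutions to forced Navier–Stokes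
  equations*, arXiv:2606.15189 (2026), §3 (Lemma 3.1, (sceltaconl), Lemmas 3.3–3.4, Remark 3.5, (scelta),
  Lemmas 3.6–3.8, Remark 3.9, §3.2) and Thm. 4.1. [GaldiGazzola2026]
* F. Gazzola, *Finite-time blow-up for the forced 2D Navier–Stokes equations*, arXiv:2608.18802 (2026).
  [Gazzola2026]
* H. Sohr, *The Navier–Stokes Equations. An Elementary Functional Analytic Approach*, Birkhäuser 2001,
  Thm. V.1.8.1.
-/

noncomputable section

open Real Set Filter Function InnerProductSpace MeasureTheory
open scoped RealInnerProductSpace ContDiff Laplacian Topology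

namespace Literature.Analysis.FluidPDE

/-- Local notation for physical space `ℝ³ = EuclideanSpace ℝ (Fin 3)`. -/
local notation "ℝ³" => EuclideanSpace ℝ (Fin 3)

/-- Local notation for the standard basis vectors. -/
local notation "𝐞" j => EuclideanSpace.single (j : Fin 3) (1 : ℝ)

namespace GaldiGazzola

/-! ### The quadratic direction field `W = 𝒫₂ = (2yz, −xz, −xy)` and its calculus -/

/-- The numerator `W(ξ) = 𝒫₂(ξ) = (2yz, −xz, −xy)` of the bubble vortex (coordinates `ξ 0, ξ 1, ξ 2` for
`x, y, z`). [cite: GaldiGazzola2026, §3.1 eq. (sceltaconl), p. 8] -/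
def dir (ξ : ℝ³) : ℝ³ := !₂[2 * ξ 1 * ξ 2, -(ξ 0 * ξ 2), -(ξ 0 * ξ 1)]

/-- The cubic field `𝒫₃(ξ) = (W·∇)W(ξ) = (−2x(y²+z²), y(x²−2z²), z(x²−2y²))` — the numerator of `(V·∇)V`.
[cite: GaldiGazzola2026, §3.2, display for (V·∇)V, p. 10] -/
def convDir (ξ : ℝ³) : ℝ³ :=
  !₂[-(2 * ξ 0 * (ξ 1 ^ 2 + ξ 2 ^ 2)), ξ 1 * (ξ 0 ^ 2 - 2 * ξ 2 ^ 2), ξ 2 * (ξ 0 ^ 2 - 2 * ξ 1 ^ 2)]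

/-- The Jacobian of `W` at `ξ` applied to `h`: `DW(ξ)h = (2(h₁ξ₂ + ξ₁h₂), −(h₀ξ₂ + ξ₀h₂), −(h₀ξ₁ + ξ₀h₁))`.
[cite: GaldiGazzola2026, §3.1 (derivatives of v¹), p. 9] -/
def dirDeriv (ξ h : ℝ³) : ℝ³ :=
  !₂[2 * (h 1 * ξ 2 + ξ 1 * h 2), -(h 0 * ξ 2 + ξ 0 * h 2), -(h 0 * ξ 1 + ξ 0 * h 1)]

/-- Components of `W`. [folklore] -/
@[simp] private theorem dir_apply_zero (ξ : ℝ³) : dir ξ 0 = 2 * ξ 1 * ξ 2 := by simp [dir]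

/-- Components of `W`. [folklore] -/
@[simp] private theorem dir_apply_one (ξ : ℝ³) : dir ξ 1 = -(ξ 0 * ξ 2) := by simp [dir]

/-- Components of `W`. [folklore] -/
@[simp] private theorem dir_apply_two (ξ : ℝ³) : dir ξ 2 = -(ξ 0 * ξ 1) := by simp [dir]

/-- Components of `𝒫₃`. [folklore] -/
@[simp] private theorem convDir_apply_zero (ξ : ℝ³) : convDir ξ 0 = -(2 * ξ 0 * (ξ 1 ^ 2 + ξ 2 ^ 2)) := by
  simp [convDir]

/-- Components of `𝒫₃`. [folklore] -/
@[simp] private theorem convDir_apply_one (ξ : ℝ³) : convDir ξ 1 = ξ 1 * (ξ 0 ^ 2 - 2 * ξ 2 ^ 2) := by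
  simp [convDir]

/-- Components of `𝒫₃`. [folklore] -/
@[simp] private theorem convDir_apply_two (ξ : ℝ³) : convDir ξ 2 = ξ 2 * (ξ 0 ^ 2 - 2 * ξ 1 ^ 2) := by
  simp [convDir]

/-- Components of `DW(ξ)h`. [folklore] -/
@[simp] private theorem dirDeriv_apply_zero (ξ h : ℝ³) : dirDeriv ξ h 0 = 2 * (h 1 * ξ 2 + ξ 1 * h 2) := by
  simp [dirDeriv]

/-- Components of `DW(ξ)h`. [folklore] -/
@[simp] private theorem dirDeriv_apply_one (ξ h : ℝ³) : dirDeriv ξ h 1 = -(h 0 * ξ 2 + ξ 0 * h 2) := by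
  simp [dirDeriv]

/-- Components of `DW(ξ)h`. [folklore] -/
@[simp] private theorem dirDeriv_apply_two (ξ h : ℝ³) : dirDeriv ξ h 2 = -(h 0 * ξ 1 + ξ 0 * h 1) := by
  simp [dirDeriv]

/-- The coordinate functions `x ↦ x j` are the projections `EuclideanSpace.proj j`. [folklore] -/
private theorem hasFDerivAt_coord (j : Fin 3) (x : ℝ³) :
    HasFDerivAt (fun y : ℝ³ => y j) (EuclideanSpace.proj j : ℝ³ →L[ℝ] ℝ) x :=
  (EuclideanSpace.proj j : ℝ³ →L[ℝ] ℝ).hasFDerivAt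

/-- The derivative `DW(ξ)` as a continuous linear map (in the shape produced by the product rule).
[cite: GaldiGazzola2026, §3.1 (derivatives of v¹), p. 9] -/
def dirFDeriv (ξ : ℝ³) : ℝ³ →L[ℝ] ℝ³ :=
  ((2 : ℝ) • (ξ 1 • (EuclideanSpace.proj (2 : Fin 3) : ℝ³ →L[ℝ] ℝ) +
      ξ 2 • (EuclideanSpace.proj (1 : Fin 3) : ℝ³ →L[ℝ] ℝ))).smulRight (𝐞 0) +
    (-(ξ 0 • (EuclideanSpace.proj (2 : Fin 3) : ℝ³ →L[ℝ] ℝ) +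
      ξ 2 • (EuclideanSpace.proj (0 : Fin 3) : ℝ³ →L[ℝ] ℝ))).smulRight (𝐞 1) +
    (-(ξ 0 • (EuclideanSpace.proj (1 : Fin 3) : ℝ³ →L[ℝ] ℝ) +
      ξ 1 • (EuclideanSpace.proj (0 : Fin 3) : ℝ³ →L[ℝ] ℝ))).smulRight (𝐞 2)

/-- `dirFDeriv ξ h = DW(ξ)h`. [cite: GaldiGazzola2026, §3.1 (derivatives of v¹), p. 9] -/
theorem dirFDeriv_apply (ξ h : ℝ³) : dirFDeriv ξ h = dirDeriv ξ h := by
  ext i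
  fin_cases i <;> simp [dirFDeriv, dirDeriv] <;> ring

/-- `W` written so that the product rule applies verbatim. [folklore] -/
private theorem dir_eq' (ξ : ℝ³) :
    dir ξ = (2 * (ξ 1 * ξ 2)) • (𝐞 0) + (-(ξ 0 * ξ 2)) • (𝐞 1) + (-(ξ 0 * ξ 1)) • (𝐞 2) := by
  ext i
  fin_cases i <;> simp
  ring

/-- `W` is differentiable with derivative `DW(ξ)`. [cite: GaldiGazzola2026, §3.1 (derivatives of v¹), p. 9] -/
theorem hasFDerivAt_dir (ξ : ℝ³) : HasFDerivAt dir (dirFDeriv ξ) ξ := by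
  have e : dir = fun y : ℝ³ =>
      (2 * (y 1 * y 2)) • (𝐞 0) + (-(y 0 * y 2)) • (𝐞 1) + (-(y 0 * y 1)) • (𝐞 2) :=
    funext dir_eq'
  rw [e]
  have h0 := (((hasFDerivAt_coord 1 ξ).mul (hasFDerivAt_coord 2 ξ)).const_mul (2 : ℝ)).smul_const (𝐞 0)
  have h1 := ((hasFDerivAt_coord 0 ξ).mul (hasFDerivAt_coord 2 ξ)).neg.smul_const (𝐞 1)
  have h2 := ((hasFDerivAt_coord 0 ξ).mul (hasFDerivAt_coord 1 ξ)).neg.smul_const (𝐞 2)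
  exact (h0.add h1).add h2

/-- `∂_h W(ξ) = DW(ξ)h`. [cite: GaldiGazzola2026, §3.1 (derivatives of v¹), p. 9] -/
theorem fderiv_dir_apply (ξ h : ℝ³) : fderiv ℝ dir ξ h = dirDeriv ξ h := by
  rw [(hasFDerivAt_dir ξ).fderiv, dirFDeriv_apply]

/-- `W` is smooth (a polynomial field). [cite: GaldiGazzola2026, §3.1 eq. (sceltaconl), p. 8] -/
theorem contDiff_dir {n : WithTop ℕ∞} : ContDiff ℝ n dir := by
  have hc : ∀ j : Fin 3, ContDiff ℝ n (fun y : ℝ³ => y j) := fun j =>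
    (EuclideanSpace.proj j : ℝ³ →L[ℝ] ℝ).contDiff
  have e : dir = fun y : ℝ³ =>
      (2 * (y 1 * y 2)) • (𝐞 0) + (-(y 0 * y 2)) • (𝐞 1) + (-(y 0 * y 1)) • (𝐞 2) :=
    funext dir_eq'
  rw [e]
  exact (((contDiff_const.mul ((hc 1).mul (hc 2))).smul contDiff_const).add
    (((hc 0).mul (hc 2)).neg.smul contDiff_const)).add (((hc 0).mul (hc 1)).neg.smul contDiff_const)

/-- **The source of the magic cancellation**: `W` is tangent to spheres, `⟨ξ, W(ξ)⟩ = 2xyz − xyz − xyz = 0`,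
so radial functions are constant along `W`. [cite: GaldiGazzola2026, Remark 3.5, p. 9] -/
theorem inner_self_dir (ξ : ℝ³) : ⟪ξ, dir ξ⟫ = 0 := by
  rw [EuclideanSpace.inner_eq_star_dotProduct]
  simp [dotProduct, Fin.sum_univ_three, dir]
  ring

/-- `tr DW(ξ) = ∂ₓ(2yz) + ∂_y(−xz) + ∂_z(−xy) = 0`. [cite: GaldiGazzola2026, §3.1 ("∇·V = 0"), p. 8] -/
theorem trace_dirFDeriv (ξ : ℝ³) : LinearMap.trace ℝ ℝ³ (dirFDeriv ξ : ℝ³ →ₗ[ℝ] ℝ³) = 0 := by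
  rw [trace_eq_sum_coord, Fin.sum_univ_three]
  simp [dirFDeriv_apply]

/-- `DW(ξ) W(ξ) = 𝒫₃(ξ) = (−2x(y²+z²), y(x²−2z²), z(x²−2y²))`.
[cite: GaldiGazzola2026, §3.2, display for (V·∇)V, p. 10] -/
theorem dirDeriv_dir (ξ : ℝ³) : dirDeriv ξ (dir ξ) = convDir ξ := by
  ext i
  fin_cases i <;> simp <;> ring

/-- Euler's identity for the quadratic field: `DW(ξ) ξ = 2 W(ξ)`.
[cite: GaldiGazzola2026, §3.1 eq. (sceltaconl), p. 8] -/
theorem dirDeriv_self (ξ : ℝ³) : dirDeriv ξ ξ = (2 : ℝ) • dir ξ := by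
  ext i
  fin_cases i <;> simp <;> ring

/-- `DW` is a symmetric bilinear expression: `DW(y) e = DW(e) y`.
[cite: GaldiGazzola2026, §3.1 (derivatives of v¹), p. 9] -/
theorem dirDeriv_comm (y e : ℝ³) : dirDeriv y e = dirDeriv e y := by
  ext i
  fin_cases i <;> simp <;> ring

/-- `W` is homogeneous of degree two: `W(kξ) = k² W(ξ)`. [cite: GaldiGazzola2026, §3.1 eq. (sceltaconl), p. 8] -/
theorem dir_smul (k : ℝ) (ξ : ℝ³) : dir (k • ξ) = k ^ 2 • dir ξ := by
  ext i
  fin_cases i <;> simp <;> ring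

/-! ### The radial profile `g(σ) = c (a + σ)^{-5/2}` and its first two derivatives -/

/-- The radial profile `g(σ) = c (a + σ)^{-5/2}` of the bubble vortex at a fixed time
(`a = (T−t)^{2γ} > 0`, `c = (T−t)^{2δ}`, `σ = |ξ|²`). [cite: GaldiGazzola2026, §3.1 eq. (scelta), p. 9] -/
def profile (a c : ℝ) (σ : ℝ) : ℝ := c * (a + σ) ^ (-(5 / 2 : ℝ))

/-- `g'(σ) = −(5/2) c (a+σ)^{-7/2}`, in the shape produced by the chain rule.
[cite: GaldiGazzola2026, §3.1 eq. (scelta), p. 9] -/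
def profile₁ (a c : ℝ) (σ : ℝ) : ℝ := c * (1 * (-(5 / 2 : ℝ)) * (a + σ) ^ (-(5 / 2 : ℝ) - 1))

/-- `g''(σ) = (35/4) c (a+σ)^{-9/2}`, in the shape produced by the chain rule.
[cite: GaldiGazzola2026, §3.1 eq. (scelta), p. 9] -/
def profile₂ (a c : ℝ) (σ : ℝ) : ℝ :=
  c * (1 * (-(5 / 2 : ℝ)) * (1 * (-(5 / 2 : ℝ) - 1) * (a + σ) ^ (-(5 / 2 : ℝ) - 1 - 1)))

/-- `g' = profile₁` where `a + σ ≠ 0`. [cite: GaldiGazzola2026, §3.1 eq. (scelta), p. 9] -/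
theorem hasDerivAt_profile {a σ : ℝ} (c : ℝ) (h : a + σ ≠ 0) :
    HasDerivAt (profile a c) (profile₁ a c σ) σ :=
  (((hasDerivAt_id' σ).const_add a).rpow_const (Or.inl h)).const_mul c

/-- `g'' = profile₂` where `a + σ ≠ 0`. [cite: GaldiGazzola2026, §3.1 eq. (scelta), p. 9] -/
theorem hasDerivAt_profile₁ {a σ : ℝ} (c : ℝ) (h : a + σ ≠ 0) :
    HasDerivAt (profile₁ a c) (profile₂ a c σ) σ :=
  ((((hasDerivAt_id' σ).const_add a).rpow_const (Or.inl h)).const_mul _).const_mul c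

/-- `g'(σ) = −(5/2) c (a+σ)^{-5/2} / (a+σ)`. [cite: GaldiGazzola2026, §3.1 eq. (scelta), p. 9] -/
theorem profile₁_eq {a σ : ℝ} (c : ℝ) (h : a + σ ≠ 0) :
    profile₁ a c σ = -(5 / 2) * c * (a + σ) ^ (-(5 / 2 : ℝ)) / (a + σ) := by
  rw [profile₁, Real.rpow_sub_one h]
  ring

/-- `g''(σ) = (35/4) c (a+σ)^{-5/2} / (a+σ)²`. [cite: GaldiGazzola2026, §3.1 eq. (scelta), p. 9] -/
theorem profile₂_eq {a σ : ℝ} (c : ℝ) (h : a + σ ≠ 0) :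
    profile₂ a c σ = 35 / 4 * c * (a + σ) ^ (-(5 / 2 : ℝ)) / (a + σ) ^ 2 := by
  rw [profile₂, Real.rpow_sub_one h, Real.rpow_sub_one h]
  field_simp
  ring

/-- `g(σ)² = c² / (a+σ)⁵`. [cite: GaldiGazzola2026, Lemma 3.4 (proof, formula for (V·∇)V), p. 8] -/
theorem profile_sq {a σ : ℝ} (c : ℝ) (h : 0 ≤ a + σ) : profile a c σ ^ 2 = c ^ 2 / (a + σ) ^ 5 := by
  rw [profile, mul_pow, ← Real.rpow_natCast ((a + σ) ^ (-(5 / 2 : ℝ))) 2, ← Real.rpow_mul h]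
  have e : (-(5 / 2 : ℝ)) * ((2 : ℕ) : ℝ) = -((5 : ℕ) : ℝ) := by norm_num
  rw [e, Real.rpow_neg h, Real.rpow_natCast, div_eq_mul_inv]

/-! ### The bubble vortex at a fixed time: `V_{a,c}(ξ) = g(|ξ|²) W(ξ)` -/

/-- The bubble vortex at a fixed time, `V_{a,c}(ξ) = c (a + |ξ|²)^{-5/2} (2yz, −xz, −xy)`
(`a = (T−t)^{2γ}`, `c = (T−t)^{2δ}`). [cite: GaldiGazzola2026, §3.1 eq. (scelta), p. 9] -/
def bubble (a c : ℝ) (ξ : ℝ³) : ℝ³ := profile a c (‖ξ‖ ^ 2) • dir ξ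

/-- Unfolding the bubble vortex. [cite: GaldiGazzola2026, §3.1 eq. (scelta), p. 9] -/
theorem bubble_apply (a c : ℝ) (ξ : ℝ³) :
    bubble a c ξ = (c * (a + ‖ξ‖ ^ 2) ^ (-(5 / 2 : ℝ))) • dir ξ := rfl

/-- `a + |ξ|² > 0` for `a > 0`. [folklore] -/
private theorem pos_of_pos {a : ℝ} (ha : 0 < a) (ξ : ℝ³) : 0 < a + ‖ξ‖ ^ 2 := by positivity

/-- **The derivative of the bubble vortex** (product rule with a radial factor):
`DV(ξ) = g(|ξ|²) DW(ξ) + 2 g'(|ξ|²) ⟨ξ, ·⟩ W(ξ)`. [cite: GaldiGazzola2026, §3.1 (derivatives of v¹), p. 9] -/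
theorem hasFDerivAt_bubble {a : ℝ} (ha : 0 < a) (c : ℝ) (ξ : ℝ³) :
    HasFDerivAt (bubble a c)
      (profile a c (‖ξ‖ ^ 2) • dirFDeriv ξ +
        ((2 * profile₁ a c (‖ξ‖ ^ 2)) • (innerSL ℝ ξ : ℝ³ →L[ℝ] ℝ)).smulRight (dir ξ)) ξ :=
  (hasFDerivAt_comp_norm_sq (hasDerivAt_profile c (pos_of_pos ha ξ).ne')).smul (hasFDerivAt_dir ξ)

/-- `DV(ξ)h = g(|ξ|²) DW(ξ)h + 2 g'(|ξ|²) ⟨ξ, h⟩ W(ξ)`.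
[cite: GaldiGazzola2026, §3.1 (derivatives of v¹), p. 9] -/
theorem fderiv_bubble_apply {a : ℝ} (ha : 0 < a) (c : ℝ) (ξ h : ℝ³) :
    fderiv ℝ (bubble a c) ξ h =
      profile a c (‖ξ‖ ^ 2) • dirDeriv ξ h + (2 * profile₁ a c (‖ξ‖ ^ 2) * ⟪ξ, h⟫) • dir ξ := by
  rw [(hasFDerivAt_bubble ha c ξ).fderiv]
  simp [dirFDeriv_apply]

/-- The bubble vortex is differentiable (`a > 0`). [cite: GaldiGazzola2026, §3.1 eq. (scelta), p. 9] -/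
theorem differentiable_bubble {a : ℝ} (ha : 0 < a) (c : ℝ) : Differentiable ℝ (bubble a c) := fun ξ =>
  (hasFDerivAt_bubble ha c ξ).differentiableAt

/-- The bubble vortex is smooth (`a > 0`). [cite: GaldiGazzola2026, §3.1 eq. (scelta), p. 9] -/
theorem contDiff_bubble {a : ℝ} (ha : 0 < a) (c : ℝ) {n : WithTop ℕ∞} : ContDiff ℝ n (bubble a c) :=
  (contDiff_const.mul ((contDiff_const.add (contDiff_norm_sq ℝ)).rpow_const_of_ne fun ξ =>
    (pos_of_pos ha ξ).ne')).smul contDiff_dir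

/-! ### Incompressibility -/

/-- **`div V = 0`**: `tr DV(ξ) = g · tr DW(ξ) + 2 g' ⟨ξ, W(ξ)⟩ = 0 + 0`.
[cite: GaldiGazzola2026, §3.1 ("satisfies ∇·V = 0 in ℝ³×[0,T)"), p. 8] -/
theorem divergence_bubble {a : ℝ} (ha : 0 < a) (c : ℝ) (ξ : ℝ³) :
    VectorCalculus.divergence (bubble a c) ξ = 0 := by
  rw [VectorCalculus.divergence, (hasFDerivAt_bubble ha c ξ).fderiv, trace_eq_sum_coord,
    Fin.sum_univ_three]
  simp [dirFDeriv_apply, EuclideanSpace.inner_single_right]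
  ring

/-- The bubble vortex is divergence free, in the tree's vocabulary (`a > 0`).
[cite: GaldiGazzola2026, §3.1 ("satisfies ∇·V = 0 in ℝ³×[0,T)") and Lemma 3.3, p. 8] -/
theorem isDivFree_bubble {a : ℝ} (ha : 0 < a) (c : ℝ) : VectorCalculus.IsDivFree (bubble a c) :=
  fun ξ => divergence_bubble ha c ξ

/-! ### The magic cancellation -/

/-- **`(V·∇)V = c² (a+|ξ|²)^{-5} 𝒫₃(ξ)`** — denominator power `ℓ = 5`, "not `1 + ℓ` as expected when
multiplying `V` with a first order derivative": the radial term `2 g' ⟨ξ, V⟩ W` of `DV(ξ)V(ξ)` vanishes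
because `⟨ξ, W(ξ)⟩ = 0` (`inner_self_dir`), leaving `g² DW(W) = g² 𝒫₃`.
[cite: GaldiGazzola2026, Lemma 3.4 (formula for (V·∇)V) and Remark 3.5, pp. 8–9; §3.2, p. 10] -/
theorem convect_bubble {a : ℝ} (ha : 0 < a) (c : ℝ) (ξ : ℝ³) :
    convect (bubble a c) (bubble a c) ξ = (c ^ 2 / (a + ‖ξ‖ ^ 2) ^ 5) • convDir ξ := by
  rw [convect, fderiv_bubble_apply ha,
    show bubble a c ξ = profile a c (‖ξ‖ ^ 2) • dir ξ from rfl, inner_smul_right, inner_self_dir,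
    mul_zero, mul_zero, zero_smul, add_zero, ← dirFDeriv_apply, map_smul, dirFDeriv_apply,
    dirDeriv_dir, smul_smul]
  congr 1
  rw [← profile_sq c (pos_of_pos ha ξ).le]
  ring

/-! ### The Laplacian: `ΔV = −35 a c (a+|ξ|²)^{-9/2} W` (the `(ℓ − 5)`-term is absent) -/

/-- `∂ (⟨·, e⟩) = ⟨e, ·⟩`. [folklore] -/
private theorem hasFDerivAt_inner_const (e ξ : ℝ³) :
    HasFDerivAt (fun y : ℝ³ => ⟪y, e⟫) (innerSL ℝ e : ℝ³ →L[ℝ] ℝ) ξ := by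
  refine ((innerSL ℝ e : ℝ³ →L[ℝ] ℝ).hasFDerivAt).congr_of_eventuallyEq
    (Eventually.of_forall fun w => ?_)
  simp only [innerSL_apply_apply]
  exact real_inner_comm e w

/-- **Second derivatives of the bubble vortex**: the derivative at `ξ` of `y ↦ DV(y) e`.
[cite: GaldiGazzola2026, Lemma 3.4 (proof, formula for ΔV), p. 8] -/
theorem hasFDerivAt_fderiv_bubble_apply {a : ℝ} (ha : 0 < a) (c : ℝ) (ξ e : ℝ³) :
    HasFDerivAt (fun y => fderiv ℝ (bubble a c) y e)
      (profile a c (‖ξ‖ ^ 2) • dirFDeriv e +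
          ((2 * profile₁ a c (‖ξ‖ ^ 2)) • (innerSL ℝ ξ : ℝ³ →L[ℝ] ℝ)).smulRight (dirFDeriv e ξ) +
        ((2 * profile₁ a c (‖ξ‖ ^ 2) * ⟪ξ, e⟫) • dirFDeriv ξ +
          ((2 * profile₁ a c (‖ξ‖ ^ 2)) • (innerSL ℝ e : ℝ³ →L[ℝ] ℝ) +
              ⟪ξ, e⟫ • ((2 : ℝ) • ((2 * profile₂ a c (‖ξ‖ ^ 2)) • (innerSL ℝ ξ : ℝ³ →L[ℝ] ℝ)))).smulRight
            (dir ξ))) ξ := by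
  have hs : a + ‖ξ‖ ^ 2 ≠ 0 := (pos_of_pos ha ξ).ne'
  have e1 : (fun y => fderiv ℝ (bubble a c) y e) = fun y =>
      profile a c (‖y‖ ^ 2) • dirFDeriv e y + (2 * profile₁ a c (‖y‖ ^ 2) * ⟪y, e⟫) • dir y := by
    funext y
    rw [fderiv_bubble_apply ha, dirDeriv_comm, ← dirFDeriv_apply]
  rw [e1]
  have hA := (hasFDerivAt_comp_norm_sq (hasDerivAt_profile c hs)).smul
    ((dirFDeriv e).hasFDerivAt (x := ξ))
  have hB := (((hasFDerivAt_comp_norm_sq (hasDerivAt_profile₁ c hs)).const_mul 2).mul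
    (hasFDerivAt_inner_const e ξ)).smul (hasFDerivAt_dir ξ)
  exact hA.add hB

/-- `|ξ|² = x² + y² + z²`. [folklore] -/
private theorem norm_sq_eq_coord (ξ : ℝ³) : ‖ξ‖ ^ 2 = ξ 0 ^ 2 + ξ 1 ^ 2 + ξ 2 ^ 2 := by
  rw [EuclideanSpace.norm_sq_eq, Fin.sum_univ_three]
  simp [sq_abs]

/-- **`ΔV(ξ) = −35 a c (a + |ξ|²)^{-5/2} (a + |ξ|²)^{-2} W(ξ)`**: `Δ(gW) = (Δg) W + 2 Σⱼ ∂ⱼg ∂ⱼW + g ΔW`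
with `ΔW = 0`, `Σⱼ ξⱼ∂ⱼW = 2W` and `Δg = 4g''|ξ|² + 6g'`; with `ℓ = 5` the `𝒫₄`-term of `ΔV` carries the
factor `(ℓ − 5) = 0` and `ΔV` is again a multiple of `W` (the source prints the numerator as `𝒫₂`; the
constant `−35` is made explicit here). [cite: GaldiGazzola2026, Lemma 3.4 (proof, formula for ΔV), p. 8] -/
theorem laplacian_bubble {a : ℝ} (ha : 0 < a) (c : ℝ) (ξ : ℝ³) :
    Δ (bubble a c) ξ =
      (-(35 * a * c) * (a + ‖ξ‖ ^ 2) ^ (-(5 / 2 : ℝ)) / (a + ‖ξ‖ ^ 2) ^ 2) • dir ξ := by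
  have hs : a + ‖ξ‖ ^ 2 ≠ 0 := (pos_of_pos ha ξ).ne'
  rw [laplacian_eq_sum_fderiv_fderiv (EuclideanSpace.basisFun (Fin 3) ℝ) (contDiff_bubble ha c) ξ,
    Fin.sum_univ_three]
  simp only [EuclideanSpace.basisFun_apply]
  rw [(hasFDerivAt_fderiv_bubble_apply ha c ξ _).fderiv, (hasFDerivAt_fderiv_bubble_apply ha c ξ _).fderiv,
    (hasFDerivAt_fderiv_bubble_apply ha c ξ _).fderiv, profile₁_eq c hs, profile₂_eq c hs, profile]
  have hn := norm_sq_eq_coord ξ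
  ext k
  fin_cases k <;>
    simp [dirFDeriv_apply, EuclideanSpace.inner_single_right] <;>
    rw [hn] <;> field_simp <;> ring

/-! ### Self-similar form and the scaling of the norms -/

/-- **Self-similar form**: `V_{R²,c}(ξ) = (c / R³) V_{1,1}(ξ / R)` (`R > 0`).
[cite: GaldiGazzola2026, Lemma 3.1 (proof: the substitution ρ = (T−t)^γ s), p. 8] -/
theorem bubble_sq (c : ℝ) {R : ℝ} (hR : 0 < R) (ξ : ℝ³) :
    bubble (R ^ 2) c ξ = (c / R ^ 3) • bubble 1 1 (R⁻¹ • ξ) := by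
  have hR2 : 0 < R ^ 2 := by positivity
  have hs : 0 < R ^ 2 + ‖ξ‖ ^ 2 := pos_of_pos hR2 ξ
  rw [bubble_apply, bubble_apply, dir_smul, smul_smul, smul_smul, norm_smul, norm_inv, Real.norm_eq_abs,
    abs_of_pos hR, one_mul]
  congr 1
  have e1 : (1 : ℝ) + (R⁻¹ * ‖ξ‖) ^ 2 = (R ^ 2)⁻¹ * (R ^ 2 + ‖ξ‖ ^ 2) := by
    field_simp
  have e2 : ((R ^ 2)⁻¹ : ℝ) ^ (-(5 / 2 : ℝ)) = R ^ 5 := by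
    rw [Real.inv_rpow hR2.le, Real.rpow_neg hR2.le, inv_inv, ← Real.rpow_natCast R 2,
      ← Real.rpow_mul hR.le, ← Real.rpow_natCast R 5]
    norm_num
  rw [e1, Real.mul_rpow (inv_nonneg.2 hR2.le) hs.le, e2]
  field_simp

/-- The derivative in self-similar form: `DV_{R²,c}(ξ) = (c/R³) DV_{1,1}(ξ/R) ∘ (R⁻¹ id)`.
[cite: GaldiGazzola2026, Lemma 3.1 (proof: the substitution ρ = (T−t)^γ s), p. 8] -/
theorem fderiv_bubble_sq (c : ℝ) {R : ℝ} (hR : 0 < R) (ξ : ℝ³) :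
    fderiv ℝ (bubble (R ^ 2) c) ξ =
      (c / R ^ 3) • (fderiv ℝ (bubble 1 1) (R⁻¹ • ξ)).comp (R⁻¹ • ContinuousLinearMap.id ℝ ℝ³) := by
  have e : bubble (R ^ 2) c = fun ξ => (c / R ^ 3) • bubble 1 1 (R⁻¹ • ξ) := funext (bubble_sq c hR)
  rw [e]
  have h1 : HasFDerivAt (fun ξ : ℝ³ => R⁻¹ • ξ) (R⁻¹ • ContinuousLinearMap.id ℝ ℝ³) ξ :=
    (hasFDerivAt_id ξ).const_smul R⁻¹
  have h2 := ((differentiable_bubble one_pos 1 (R⁻¹ • ξ)).hasFDerivAt.comp ξ h1).const_smul (c / R ^ 3)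
  exact h2.fderiv

/-- Frobenius norm under scaling: `|k L ∘ (r id)|² = (kr)² |L|²`. [folklore] -/
private theorem frobeniusNormSq_smul_comp_smul (k r : ℝ) (L : ℝ³ →L[ℝ] ℝ³) :
    frobeniusNormSq (k • L.comp (r • ContinuousLinearMap.id ℝ ℝ³)) = (k * r) ^ 2 * frobeniusNormSq L := by
  simp only [frobeniusNormSq, FunLike.coe_smul, Pi.smul_apply, ContinuousLinearMap.comp_apply,
    ContinuousLinearMap.id_apply, map_smul, norm_smul, Real.norm_eq_abs, Finset.mul_sum]
  refine Finset.sum_congr rfl fun i _ => ?_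
  rw [mul_pow, mul_pow, mul_pow, sq_abs, sq_abs]
  ring

/-- `dim ℝ³ = 3`. [folklore] -/
private theorem finrank_R3 : Module.finrank ℝ ℝ³ = 3 := finrank_euclideanSpace_fin

/-- **Scaling of the `L^q` masses**: `∫ |V_{R²,c}|^q = (c/R³)^q R³ ∫ |V_{1,1}|^q` (`c ≥ 0`, `R > 0`, any real
`q`; both sides are Bochner integrals and are `0` together when `|V_{1,1}|^q` is not integrable).
[cite: GaldiGazzola2026, Lemma 3.1 eq. (general) and (VLqq), p. 8] -/
theorem integral_norm_rpow_bubble_sq {c R : ℝ} (hc : 0 ≤ c) (hR : 0 < R) (q : ℝ) :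
    ∫ ξ, ‖bubble (R ^ 2) c ξ‖ ^ q = (c / R ^ 3) ^ q * R ^ 3 * ∫ ξ, ‖bubble 1 1 ξ‖ ^ q := by
  have hk : 0 ≤ c / R ^ 3 := by positivity
  have e : (fun ξ : ℝ³ => ‖bubble (R ^ 2) c ξ‖ ^ q) =
      fun ξ => (c / R ^ 3) ^ q * ‖bubble 1 1 (R⁻¹ • ξ)‖ ^ q := by
    funext ξ
    rw [bubble_sq c hR, norm_smul, Real.norm_eq_abs, abs_of_nonneg hk, Real.mul_rpow hk (norm_nonneg _)]
  have h := Measure.integral_comp_inv_smul_of_nonneg volume (fun η : ℝ³ => ‖bubble 1 1 η‖ ^ q) hR.le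
  rw [e, integral_const_mul, h, finrank_R3, smul_eq_mul, mul_assoc]

/-- **Scaling of the enstrophy**: `‖∇V_{R²,c}‖₂² = c² R⁻⁵ ‖∇V_{1,1}‖₂²` (`R > 0`; the tree's `gradNormSq`,
Frobenius norm of the Jacobian). [cite: GaldiGazzola2026, Lemma 3.7 (proof) eq. (nablaV2), p. 9] -/
theorem gradNormSq_bubble_sq (c : ℝ) {R : ℝ} (hR : 0 < R) :
    VectorCalculus.gradNormSq (bubble (R ^ 2) c) = c ^ 2 / R ^ 5 * VectorCalculus.gradNormSq (bubble 1 1) := by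
  unfold VectorCalculus.gradNormSq
  have e : (fun ξ : ℝ³ => frobeniusNormSq (fderiv ℝ (bubble (R ^ 2) c) ξ)) =
      fun ξ => (c / R ^ 3 * R⁻¹) ^ 2 * frobeniusNormSq (fderiv ℝ (bubble 1 1) (R⁻¹ • ξ)) := by
    funext ξ
    rw [fderiv_bubble_sq c hR, frobeniusNormSq_smul_comp_smul]
  have h := Measure.integral_comp_inv_smul_of_nonneg volume
    (fun η : ℝ³ => frobeniusNormSq (fderiv ℝ (bubble 1 1) η)) hR.le
  rw [e, integral_const_mul, h, finrank_R3, smul_eq_mul, ← mul_assoc]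
  congr 1
  field_simp

/-! ### The time-dependent field (scelta), extended past `T` by `|T − t|` -/

/-- **The Galdi–Gazzola bubble vortex** `V(ξ,t) = |T−t|^{2δ} (2yz, −xz, −xy) / [|T−t|^{2γ} + |ξ|²]^{5/2}`:
eq. (scelta) of §3.1, with `(T − t)` replaced by `|T − t|` as in the proof of Thm. 4.1 (extension past the
blow-up time). [cite: GaldiGazzola2026, §3.1 eq. (scelta), p. 9, and Thm. 4.1 (proof), p. 12] -/
def vortex (T δ γ : ℝ) (t : ℝ) (ξ : ℝ³) : ℝ³ := bubble (|T - t| ^ (2 * γ)) (|T - t| ^ (2 * δ)) ξ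

/-- The printed formula (with `|T − t|`). [cite: GaldiGazzola2026, §3.1 eq. (scelta), p. 9] -/
theorem vortex_eq (T δ γ t : ℝ) (ξ : ℝ³) :
    vortex T δ γ t ξ = (|T - t| ^ (2 * δ) / (|T - t| ^ (2 * γ) + ‖ξ‖ ^ 2) ^ (5 / 2 : ℝ)) •
      !₂[2 * ξ 1 * ξ 2, -(ξ 0 * ξ 2), -(ξ 0 * ξ 1)] := by
  rw [vortex, bubble_apply, Real.rpow_neg (by positivity), div_eq_mul_inv]
  rfl

/-- **The printed formula (scelta) before the blow-up time**:
`V(ξ,t) = (T−t)^{2δ} (2yz, −xz, −xy) / [(T−t)^{2γ} + |ξ|²]^{5/2}` for `t < T`.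
[cite: GaldiGazzola2026, §3.1 eq. (scelta), p. 9] -/
theorem vortex_eq_of_lt {T t : ℝ} (δ γ : ℝ) (ht : t < T) (ξ : ℝ³) :
    vortex T δ γ t ξ = ((T - t) ^ (2 * δ) / ((T - t) ^ (2 * γ) + ‖ξ‖ ^ 2) ^ (5 / 2 : ℝ)) •
      !₂[2 * ξ 1 * ξ 2, -(ξ 0 * ξ 2), -(ξ 0 * ξ 1)] := by
  rw [vortex_eq, abs_of_pos (sub_pos.2 ht)]

/-- `|T − t| > 0` off the blow-up time. [folklore] -/
private theorem abs_pos_of_ne {T t : ℝ} (ht : t ≠ T) : 0 < |T - t| :=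
  abs_pos.2 (sub_ne_zero.2 (Ne.symm ht))

/-- `|T − t|^p > 0` off the blow-up time. [folklore] -/
private theorem rpow_abs_pos {T t : ℝ} (ht : t ≠ T) (p : ℝ) : 0 < |T - t| ^ p :=
  Real.rpow_pos_of_pos (abs_pos_of_ne ht) p

/-- At the blow-up time the (extended) field vanishes identically (`δ ≠ 0`): "`V(ξ,T) = 0` in `ℝ³ ∖ {0}`"
(and `= 0` at `ξ = 0` too, by `0/0 = 0`). [cite: GaldiGazzola2026, Thm. 4.1 (proof), p. 12] -/
theorem vortex_blowupTime {δ : ℝ} (T γ : ℝ) (hδ : δ ≠ 0) : vortex T δ γ T = 0 := by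
  funext ξ
  rw [vortex, bubble_apply, sub_self, abs_zero, Real.zero_rpow (mul_ne_zero two_ne_zero hδ), zero_mul,
    zero_smul]
  rfl

/-- Every time slice off the blow-up time is smooth in space.
[cite: GaldiGazzola2026, Thm. 4.1 (last clause), p. 12] -/
theorem contDiff_vortex {T t : ℝ} (δ γ : ℝ) (ht : t ≠ T) {n : WithTop ℕ∞} : ContDiff ℝ n (vortex T δ γ t) :=
  contDiff_bubble (rpow_abs_pos ht _) _

/-- **Joint smoothness off the blow-up time**: `V ∈ C^∞((ℝ ∖ {T}) × ℝ³)` — the part of the last clause of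
Thm. 4.1 ("`V ∈ C^∞(ℝ³×ℝ₊ ∖ {(0,T)})`") that holds; see `not_differentiableAt_vortex_blowupTime` for the
hyperplane `t = T`. [cite: GaldiGazzola2026, Thm. 4.1 (last clause), p. 12] -/
theorem contDiffOn_uncurry_vortex (T δ γ : ℝ) :
    ContDiffOn ℝ ∞ (uncurry (vortex T δ γ)) ({t | t ≠ T} ×ˢ univ) := by
  intro p hp
  have ht : p.1 ≠ T := (mem_prod.1 hp).1
  apply ContDiffAt.contDiffWithinAt
  have e : uncurry (vortex T δ γ) = fun p : ℝ × ℝ³ =>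
      (|T - p.1| ^ (2 * δ) * (|T - p.1| ^ (2 * γ) + ‖p.2‖ ^ 2) ^ (-(5 / 2 : ℝ))) • dir p.2 := by
    funext p
    rfl
  rw [e]
  have hT : T - p.1 ≠ 0 := sub_ne_zero.2 (Ne.symm ht)
  have habs : ContDiffAt ℝ ∞ (fun p : ℝ × ℝ³ => |T - p.1|) p :=
    (contDiffAt_norm ℝ hT).comp p (contDiffAt_const.sub contDiffAt_fst)
  have hne : |T - p.1| ≠ 0 := abs_ne_zero.2 hT
  have hc : ContDiffAt ℝ ∞ (fun p : ℝ × ℝ³ => |T - p.1| ^ (2 * δ)) p := habs.rpow_const_of_ne hne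
  have ha : ContDiffAt ℝ ∞ (fun p : ℝ × ℝ³ => |T - p.1| ^ (2 * γ)) p := habs.rpow_const_of_ne hne
  have hpos : 0 < |T - p.1| ^ (2 * γ) + ‖p.2‖ ^ 2 := pos_of_pos (rpow_abs_pos ht _) p.2
  have hs : ContDiffAt ℝ ∞ (fun p : ℝ × ℝ³ => (|T - p.1| ^ (2 * γ) + ‖p.2‖ ^ 2) ^ (-(5 / 2 : ℝ))) p :=
    (ha.add ((contDiff_norm_sq ℝ).comp contDiff_snd).contDiffAt).rpow_const_of_ne hpos.ne'
  exact (hc.mul hs).smul (contDiff_dir.comp contDiff_snd).contDiffAt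

/-! ### The ingredients of the equations along the time-dependent field -/

/-- **`∇·V(·,t) = 0`** (`t ≠ T`). [cite: GaldiGazzola2026, §3.1 ("∇·V = 0 in ℝ³×[0,T)") and Lemma 3.3, p. 8] -/
theorem isDivFree_vortex {T t : ℝ} (δ γ : ℝ) (ht : t ≠ T) : VectorCalculus.IsDivFree (vortex T δ γ t) :=
  isDivFree_bubble (rpow_abs_pos ht _) _

/-- `(x^{2δ})² = x^{4δ}` for `x ≥ 0`. [folklore] -/
private theorem rpow_two_mul_sq (x δ : ℝ) (hx : 0 ≤ x) : (x ^ (2 * δ)) ^ 2 = x ^ (4 * δ) := by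
  rw [← Real.rpow_natCast, ← Real.rpow_mul hx]
  congr 1
  push_cast
  ring

/-- **The magic cancellation along the field**:
`(V·∇)V(ξ,t) = |T−t|^{4δ} (−2x(y²+z²), y(x²−2z²), z(x²−2y²)) / [|T−t|^{2γ} + |ξ|²]^5` (`t ≠ T`) —
denominator power `5`. [cite: GaldiGazzola2026, §3.2 (display for (V·∇)V), p. 10; Remark 3.5, p. 9] -/
theorem convect_vortex {T t : ℝ} (δ γ : ℝ) (ht : t ≠ T) (ξ : ℝ³) :
    convect (vortex T δ γ t) (vortex T δ γ t) ξ =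
      (|T - t| ^ (4 * δ) / (|T - t| ^ (2 * γ) + ‖ξ‖ ^ 2) ^ 5) •
        !₂[-(2 * ξ 0 * (ξ 1 ^ 2 + ξ 2 ^ 2)), ξ 1 * (ξ 0 ^ 2 - 2 * ξ 2 ^ 2), ξ 2 * (ξ 0 ^ 2 - 2 * ξ 1 ^ 2)] := by
  have e : vortex T δ γ t = bubble (|T - t| ^ (2 * γ)) (|T - t| ^ (2 * δ)) := rfl
  rw [e, convect_bubble (rpow_abs_pos ht _), rpow_two_mul_sq _ _ (abs_nonneg _)]
  rfl

/-- **`ΔV(ξ,t) = −35 |T−t|^{2δ+2γ} [|T−t|^{2γ}+|ξ|²]^{-5/2} [|T−t|^{2γ}+|ξ|²]^{-2} W(ξ)`** (`t ≠ T`).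
[cite: GaldiGazzola2026, Lemma 3.4 (proof, formula for ΔV with the factor (ℓ − 5)), p. 8; (summable), p. 10] -/
theorem laplacian_vortex {T t : ℝ} (δ γ : ℝ) (ht : t ≠ T) (ξ : ℝ³) :
    Δ (vortex T δ γ t) ξ =
      (-(35 * |T - t| ^ (2 * δ + 2 * γ)) * (|T - t| ^ (2 * γ) + ‖ξ‖ ^ 2) ^ (-(5 / 2 : ℝ)) /
          (|T - t| ^ (2 * γ) + ‖ξ‖ ^ 2) ^ 2) • dir ξ := by
  have e : vortex T δ γ t = bubble (|T - t| ^ (2 * γ)) (|T - t| ^ (2 * δ)) := rfl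
  rw [e, laplacian_bubble (rpow_abs_pos ht _), Real.rpow_add (abs_pos_of_ne ht)]
  congr 1
  ring

/-! ### The exact power laws of the norms -/

/-- `x^{2γ} = (x^γ)²` for `x ≥ 0`. [folklore] -/
private theorem rpow_mul_two (x γ : ℝ) (hx : 0 ≤ x) : x ^ (2 * γ) = (x ^ γ) ^ 2 := by
  rw [← Real.rpow_natCast, ← Real.rpow_mul hx]
  congr 1
  push_cast
  ring

/-- The time slice as a rescaled bubble with `R = |T−t|^γ`. [folklore] -/
private theorem vortex_eq_bubble_sq (T δ γ t : ℝ) :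
    vortex T δ γ t = bubble ((|T - t| ^ γ) ^ 2) (|T - t| ^ (2 * δ)) := by
  funext ξ
  rw [vortex, rpow_mul_two _ _ (abs_nonneg _)]

/-- Exponent bookkeeping for the `L^q` law. [folklore] -/
private theorem scaling_exponent {x : ℝ} (hx : 0 < x) (δ γ q : ℝ) :
    (x ^ (2 * δ) / (x ^ γ) ^ 3) ^ q * (x ^ γ) ^ 3 = x ^ (2 * q * δ + (3 - 3 * q) * γ) := by
  rw [← Real.rpow_natCast (x ^ γ) 3, ← Real.rpow_mul hx.le, ← Real.rpow_sub hx, ← Real.rpow_mul hx.le,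
    ← Real.rpow_add hx]
  congr 1
  push_cast
  ring

/-- Exponent bookkeeping for the enstrophy law. [folklore] -/
private theorem scaling_exponent' {x : ℝ} (hx : 0 < x) (δ γ : ℝ) :
    (x ^ (2 * δ)) ^ 2 / (x ^ γ) ^ 5 = x ^ (4 * δ - 5 * γ) := by
  rw [← Real.rpow_natCast (x ^ (2 * δ)) 2, ← Real.rpow_mul hx.le, ← Real.rpow_natCast (x ^ γ) 5,
    ← Real.rpow_mul hx.le, ← Real.rpow_sub hx]
  congr 1
  push_cast
  ring

/-- **`‖V(t)‖_{L^q}^q = C_q |T−t|^{2qδ + (3−3q)γ}`** with `C_q = ∫ |V_{1,1}|^q` the `L^q`-mass of the unit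
profile ((VLqq) with `ℓ = 5`: `2qδ + (2q+3−5q)γ`; any real `q`, `t ≠ T`; both sides Bochner integrals).
[cite: GaldiGazzola2026, §3.1 eq. (VLqq) and Lemma 3.1 eq. (general), p. 8] -/
theorem integral_norm_rpow_vortex {T t : ℝ} (δ γ : ℝ) (ht : t ≠ T) (q : ℝ) :
    ∫ ξ, ‖vortex T δ γ t ξ‖ ^ q = |T - t| ^ (2 * q * δ + (3 - 3 * q) * γ) * ∫ ξ, ‖bubble 1 1 ξ‖ ^ q := by
  rw [vortex_eq_bubble_sq, integral_norm_rpow_bubble_sq (rpow_abs_pos ht _).le (rpow_abs_pos ht _),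
    scaling_exponent (abs_pos_of_ne ht)]

/-- **Energy**: `‖V(t)‖₂² = C |T−t|^{4δ−3γ}`, `C = ‖V_{1,1}‖₂²`.
[cite: GaldiGazzola2026, §3.1 eq. (VLqq) with q = 2, p. 8] -/
theorem integral_norm_sq_vortex {T t : ℝ} (δ γ : ℝ) (ht : t ≠ T) :
    ∫ ξ, ‖vortex T δ γ t ξ‖ ^ 2 = |T - t| ^ (4 * δ - 3 * γ) * ∫ ξ, ‖bubble 1 1 ξ‖ ^ 2 := by
  have h := integral_norm_rpow_vortex δ γ ht (T := T) 2
  simp only [Real.rpow_two] at h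
  rw [h]
  congr 1
  ring_nf

/-- **`L³`-mass**: `‖V(t)‖₃³ = C |T−t|^{6δ−6γ}`, `C = ‖V_{1,1}‖₃³` (so `‖V(t)‖₃ → ∞` iff `δ < γ`, given
`0 < C < ∞`). [cite: GaldiGazzola2026, Lemma 3.7 (proof: ‖V(t)‖₃³ = C(T−t)^{6δ−6γ}), p. 9] -/
theorem integral_norm_cube_vortex {T t : ℝ} (δ γ : ℝ) (ht : t ≠ T) :
    ∫ ξ, ‖vortex T δ γ t ξ‖ ^ 3 = |T - t| ^ (6 * δ - 6 * γ) * ∫ ξ, ‖bubble 1 1 ξ‖ ^ 3 := by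
  have h := integral_norm_rpow_vortex δ γ ht (T := T) 3
  simp only [Real.rpow_ofNat] at h
  rw [h]
  congr 1
  ring_nf

/-- **Enstrophy**: `‖∇V(t)‖₂² = C |T−t|^{4δ−5γ}` with `C = ‖∇V_{1,1}‖₂²` (so the enstrophy blows up as
`t → T` iff `4δ < 5γ`, given `0 < C < ∞` — the radial integral of Lemma 3.1, not evaluated here).
[cite: GaldiGazzola2026, Lemma 3.7 (proof) eq. (nablaV2), p. 9] -/
theorem gradNormSq_vortex {T t : ℝ} (δ γ : ℝ) (ht : t ≠ T) :
    VectorCalculus.gradNormSq (vortex T δ γ t) =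
      |T - t| ^ (4 * δ - 5 * γ) * VectorCalculus.gradNormSq (bubble 1 1) := by
  rw [vortex_eq_bubble_sq, gradNormSq_bubble_sq _ (rpow_abs_pos ht _), scaling_exponent' (abs_pos_of_ne ht)]

/-! ### The time derivative before the blow-up time -/

/-- **`V_t`** for `t < T`: `V_t = (−2δ (T−t)^{2δ−1} [..]^{-5/2} + 5γ (T−t)^{2δ+2γ−1} [..]^{-7/2}) W`,
`[..] = (T−t)^{2γ} + |ξ|²` (the source prints the two numerators as `𝒫₂`; constants made explicit).
[cite: GaldiGazzola2026, Lemma 3.4 (proof, formula for V_t), p. 8; eq. (Vt), p. 10] -/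
theorem hasDerivAt_vortex {T t : ℝ} (δ γ : ℝ) (ht : t < T) (ξ : ℝ³) :
    HasDerivAt (fun s => vortex T δ γ s ξ)
      ((-(2 * δ) * (T - t) ^ (2 * δ - 1) / ((T - t) ^ (2 * γ) + ‖ξ‖ ^ 2) ^ (5 / 2 : ℝ) +
          5 * γ * (T - t) ^ (2 * δ + 2 * γ - 1) / ((T - t) ^ (2 * γ) + ‖ξ‖ ^ 2) ^ (7 / 2 : ℝ)) •
        dir ξ) t := by
  have hu : 0 < T - t := sub_pos.2 ht
  have hs : 0 < (T - t) ^ (2 * γ) + ‖ξ‖ ^ 2 := pos_of_pos (Real.rpow_pos_of_pos hu _) ξ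
  -- near `t` the absolute value is `T - s`
  have heq : (fun s => ((T - s) ^ (2 * δ) * ((T - s) ^ (2 * γ) + ‖ξ‖ ^ 2) ^ (-(5 / 2 : ℝ))) • dir ξ)
      =ᶠ[𝓝 t] fun s => vortex T δ γ s ξ := by
    filter_upwards [Iio_mem_nhds ht] with s hs'
    rw [vortex, bubble_apply, abs_of_pos (sub_pos.2 hs')]
  refine HasDerivAt.congr_of_eventuallyEq ?_ heq.symm
  have h1 : HasDerivAt (fun s : ℝ => T - s) (-1) t := by
    simpa using (hasDerivAt_id' t).const_sub T
  have hc := h1.rpow_const (p := 2 * δ) (Or.inl hu.ne')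
  have ha := ((h1.rpow_const (p := 2 * γ) (Or.inl hu.ne')).add_const (‖ξ‖ ^ 2)).rpow_const
    (p := -(5 / 2 : ℝ)) (Or.inl hs.ne')
  have h := (hc.mul ha).smul_const (dir ξ)
  refine h.congr_deriv ?_
  congr 1
  rw [show (-(5 / 2 : ℝ) - 1) = -(7 / 2 : ℝ) by norm_num, Real.rpow_neg hs.le, Real.rpow_neg hs.le,
    show (2 * δ + 2 * γ - 1) = 2 * δ + (2 * γ - 1) by ring, Real.rpow_add hu]
  field_simp

/-! ### Erratum: no time regularity at `t = T` away from `W = 0` -/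

/-- **The extended field is NOT differentiable in time at the blow-up time**, at every point `ξ` with
`W(ξ) ≠ 0`, whenever `0 < 2δ < 1` and `γ ≥ 0` (all of the triangles `A`, `B` of Thms. 4.1/4.5 lie in
`1/3 < δ < 1/2`): `t ↦ V(ξ,t) = |T−t|^{2δ} [|T−t|^{2γ}+|ξ|²]^{-5/2} W(ξ)` is `O(|t−T|)` at `T` only if
`|T−t|^{2δ−1}` stays bounded. Hence the last clause of Thm. 4.1, "`V ∈ C^∞(ℝ³×ℝ₊ ∖ {(0,T)})`" (for the
extension "with `(T−t)` replaced by `|T−t|`"), holds on `ℝ³ × (ℝ₊ ∖ {T})` (`contDiffOn_uncurry_vortex`) but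
fails across the hyperplane `t = T`; the blow-up assertions of the theorem are unaffected.
[cite: GaldiGazzola2026, Thm. 4.1 (last clause and proof), p. 12] -/
theorem not_differentiableAt_vortex_blowupTime {T δ γ : ℝ} (hδ : 0 < δ) (hδ' : 2 * δ < 1) (hγ : 0 ≤ γ)
    {ξ : ℝ³} (hξ : dir ξ ≠ 0) : ¬ DifferentiableAt ℝ (fun t => vortex T δ γ t ξ) T := by
  intro hV
  have hξ0 : ξ ≠ 0 := by
    rintro rfl
    exact hξ (by ext i; fin_cases i <;> simp)
  have hσ : 0 < ‖ξ‖ ^ 2 := pow_pos (norm_pos_iff.2 hξ0) 2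
  set h : ℝ → ℝ := fun t => |T - t| ^ (2 * δ) * (|T - t| ^ (2 * γ) + ‖ξ‖ ^ 2) ^ (-(5 / 2 : ℝ)) with hh
  -- the scalar amplitude is differentiable at `T`, vanishes there, hence is `O(t − T)`
  have hw : ‖dir ξ‖ ^ 2 ≠ 0 := pow_ne_zero 2 (norm_ne_zero_iff.2 hξ)
  have hh_eq : h = fun t => (‖dir ξ‖ ^ 2)⁻¹ * ⟪vortex T δ γ t ξ, dir ξ⟫ := by
    funext t
    show h t = (‖dir ξ‖ ^ 2)⁻¹ * ⟪h t • dir ξ, dir ξ⟫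
    rw [real_inner_smul_left, real_inner_self_eq_norm_sq]
    field_simp
  have hd : DifferentiableAt ℝ h T := by
    rw [hh_eq]
    exact (hV.inner ℝ (differentiableAt_const _)).const_mul _
  have h0 : h T = 0 := by
    simp only [hh, sub_self, abs_zero, Real.zero_rpow (by positivity : (2 * δ) ≠ 0), zero_mul]
  obtain ⟨C, hC⟩ := hd.hasFDerivAt.isBigO_sub.bound
  -- lower bound `m |T−t|^{2δ} ≤ h t` for `|T − t| ≤ 1`
  set m : ℝ := (1 + ‖ξ‖ ^ 2) ^ (-(5 / 2 : ℝ)) with hm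
  have hm0 : 0 < m := Real.rpow_pos_of_pos (by positivity) _
  have hlow : ∀ t, |T - t| ≤ 1 → m * |T - t| ^ (2 * δ) ≤ h t := by
    intro t ht1
    have hx : |T - t| ^ (2 * γ) ≤ 1 := Real.rpow_le_one (abs_nonneg _) ht1 (by positivity)
    have hpos : 0 < |T - t| ^ (2 * γ) + ‖ξ‖ ^ 2 :=
      add_pos_of_nonneg_of_pos (Real.rpow_nonneg (abs_nonneg _) _) hσ
    have h1 : m ≤ (|T - t| ^ (2 * γ) + ‖ξ‖ ^ 2) ^ (-(5 / 2 : ℝ)) :=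
      Real.rpow_le_rpow_of_nonpos hpos (by linarith) (by norm_num)
    calc m * |T - t| ^ (2 * δ) ≤ (|T - t| ^ (2 * γ) + ‖ξ‖ ^ 2) ^ (-(5 / 2 : ℝ)) * |T - t| ^ (2 * δ) :=
          mul_le_mul_of_nonneg_right h1 (Real.rpow_nonneg (abs_nonneg _) _)
      _ = h t := by simp only [hh]; ring
  -- `C |T − t|^{1−2δ} → 0` as `t → T`
  have hlim : Tendsto (fun t => C * |T - t| ^ (1 - 2 * δ)) (𝓝 T) (𝓝 0) := by
    have hc : Continuous (fun t : ℝ => C * |T - t| ^ (1 - 2 * δ)) :=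
      continuous_const.mul (((continuous_const.sub continuous_id).abs).rpow_const fun x =>
        Or.inr (by linarith))
    have := hc.tendsto T
    simpa [Real.zero_rpow (by linarith : (1 - 2 * δ) ≠ 0)] using this
  have hball : ∀ᶠ t in 𝓝 T, |T - t| ≤ 1 := by
    filter_upwards [Metric.closedBall_mem_nhds T one_pos] with t ht
    rwa [Metric.mem_closedBall, dist_comm, Real.dist_eq] at ht
  have hev1 : ∀ᶠ t in 𝓝[≠] T, m * |T - t| ^ (2 * δ) ≤ C * |T - t| := by
    filter_upwards [nhdsWithin_le_nhds hC, nhdsWithin_le_nhds hball] with t h1 h2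
    rw [h0, sub_zero, Real.norm_eq_abs, Real.norm_eq_abs, abs_sub_comm t T] at h1
    exact (hlow t h2).trans ((le_abs_self _).trans h1)
  have hev2 : ∀ᶠ t in 𝓝[≠] T, C * |T - t| ^ (1 - 2 * δ) < m :=
    nhdsWithin_le_nhds (hlim.eventually (gt_mem_nhds hm0))
  obtain ⟨t, ⟨h1, h2⟩, h3⟩ := ((hev1.and hev2).and self_mem_nhdsWithin).exists
  have hpos : 0 < |T - t| := abs_pos_of_ne h3
  have hsplit : C * |T - t| = C * |T - t| ^ (1 - 2 * δ) * |T - t| ^ (2 * δ) := by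
    rw [mul_assoc, ← Real.rpow_add hpos]
    norm_num
  rw [hsplit] at h1
  have := le_of_mul_le_mul_right h1 (Real.rpow_pos_of_pos hpos _)
  linarith


/-! ### The unit-profile constants are finite and positive (the radial integral of Lemma 3.1, by domination) -/

/-- `|W(ξ)| ≤ 2|ξ|²`. [folklore] -/
private theorem norm_dir_le (ξ : ℝ³) : ‖dir ξ‖ ≤ 2 * ‖ξ‖ ^ 2 := by
  have h1 : ‖dir ξ‖ ^ 2 = (2 * ξ 1 * ξ 2) ^ 2 + (-(ξ 0 * ξ 2)) ^ 2 + (-(ξ 0 * ξ 1)) ^ 2 := by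
    simp only [EuclideanSpace.norm_sq_eq, Fin.sum_univ_three, Real.norm_eq_abs, sq_abs, dir_apply_zero,
      dir_apply_one, dir_apply_two]
  have hn := norm_sq_eq_coord ξ
  refine (pow_le_pow_iff_left₀ (norm_nonneg _) (by positivity) two_ne_zero).1 ?_
  have e4 : (2 * ‖ξ‖ ^ 2) ^ 2 = 4 * (ξ 0 ^ 2 + ξ 1 ^ 2 + ξ 2 ^ 2) ^ 2 := by
    rw [← hn]
    ring
  rw [h1, e4]
  nlinarith [sq_nonneg (ξ 0 ^ 2), sq_nonneg (ξ 1 ^ 2), sq_nonneg (ξ 2 ^ 2),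
    mul_nonneg (sq_nonneg (ξ 0)) (sq_nonneg (ξ 1)), mul_nonneg (sq_nonneg (ξ 0)) (sq_nonneg (ξ 2)),
    mul_nonneg (sq_nonneg (ξ 1)) (sq_nonneg (ξ 2))]

/-- `|DW(ξ)h| ≤ 4|ξ||h|`. [folklore] -/
private theorem norm_dirDeriv_le (ξ h : ℝ³) : ‖dirDeriv ξ h‖ ≤ 4 * ‖ξ‖ * ‖h‖ := by
  have h1 : ‖dirDeriv ξ h‖ ^ 2 =
      (2 * (h 1 * ξ 2 + ξ 1 * h 2)) ^ 2 + (-(h 0 * ξ 2 + ξ 0 * h 2)) ^ 2 + (-(h 0 * ξ 1 + ξ 0 * h 1)) ^ 2 := by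
    simp only [EuclideanSpace.norm_sq_eq, Fin.sum_univ_three, Real.norm_eq_abs, sq_abs, dirDeriv_apply_zero,
      dirDeriv_apply_one, dirDeriv_apply_two]
  have hn := norm_sq_eq_coord ξ
  have hh := norm_sq_eq_coord h
  refine (pow_le_pow_iff_left₀ (norm_nonneg _) (by positivity) two_ne_zero).1 ?_
  have e : (4 * ‖ξ‖ * ‖h‖) ^ 2 = 16 * (ξ 0 ^ 2 + ξ 1 ^ 2 + ξ 2 ^ 2) * (h 0 ^ 2 + h 1 ^ 2 + h 2 ^ 2) := by
    rw [← hn, ← hh]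
    ring
  rw [h1, e]
  nlinarith [sq_nonneg (h 1 * ξ 2 - ξ 1 * h 2), sq_nonneg (h 0 * ξ 2 - ξ 0 * h 2),
    sq_nonneg (h 0 * ξ 1 - ξ 0 * h 1),
    mul_nonneg (sq_nonneg (ξ 0)) (sq_nonneg (h 0)), mul_nonneg (sq_nonneg (ξ 0)) (sq_nonneg (h 1)),
    mul_nonneg (sq_nonneg (ξ 0)) (sq_nonneg (h 2)), mul_nonneg (sq_nonneg (ξ 1)) (sq_nonneg (h 0)),
    mul_nonneg (sq_nonneg (ξ 1)) (sq_nonneg (h 1)), mul_nonneg (sq_nonneg (ξ 1)) (sq_nonneg (h 2)),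
    mul_nonneg (sq_nonneg (ξ 2)) (sq_nonneg (h 0)), mul_nonneg (sq_nonneg (ξ 2)) (sq_nonneg (h 1)),
    mul_nonneg (sq_nonneg (ξ 2)) (sq_nonneg (h 2))]

/-- Pointwise bound on the unit profile: `|V_{1,1}(ξ)| ≤ 2 (1+|ξ|²)^{-5/2} |ξ|²`. [folklore] -/
private theorem norm_bubble_one_le (ξ : ℝ³) :
    ‖bubble 1 1 ξ‖ ≤ 2 * (1 + ‖ξ‖ ^ 2) ^ (-(5 / 2 : ℝ)) * ‖ξ‖ ^ 2 := by
  have hg : 0 < (1 + ‖ξ‖ ^ 2) ^ (-(5 / 2 : ℝ)) := Real.rpow_pos_of_pos (by positivity) _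
  rw [bubble_apply, norm_smul, one_mul, Real.norm_eq_abs, abs_of_pos hg]
  calc (1 + ‖ξ‖ ^ 2) ^ (-(5 / 2 : ℝ)) * ‖dir ξ‖ ≤ (1 + ‖ξ‖ ^ 2) ^ (-(5 / 2 : ℝ)) * (2 * ‖ξ‖ ^ 2) :=
        mul_le_mul_of_nonneg_left (norm_dir_le ξ) hg.le
    _ = _ := by ring

/-- Pointwise bound on the Jacobian of the unit profile:
`|DV_{1,1}(ξ)h| ≤ 14 (1+|ξ|²)^{-5/2} |ξ| |h|`. [folklore] -/
private theorem norm_fderiv_bubble_one_le (ξ h : ℝ³) :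
    ‖fderiv ℝ (bubble 1 1) ξ h‖ ≤ 14 * (1 + ‖ξ‖ ^ 2) ^ (-(5 / 2 : ℝ)) * ‖ξ‖ * ‖h‖ := by
  have hs : 0 < 1 + ‖ξ‖ ^ 2 := by positivity
  have hg : 0 < (1 + ‖ξ‖ ^ 2) ^ (-(5 / 2 : ℝ)) := Real.rpow_pos_of_pos hs _
  set g := (1 + ‖ξ‖ ^ 2) ^ (-(5 / 2 : ℝ)) with hgdef
  rw [fderiv_bubble_apply one_pos, profile₁_eq 1 hs.ne', profile]
  have hin : |⟪ξ, h⟫| ≤ ‖ξ‖ * ‖h‖ := abs_real_inner_le_norm ξ h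
  have hfrac : ‖ξ‖ ^ 2 / (1 + ‖ξ‖ ^ 2) ≤ 1 := by
    rw [div_le_one hs]
    linarith
  calc ‖(1 * g) • dirDeriv ξ h + (2 * (-(5 / 2) * 1 * g / (1 + ‖ξ‖ ^ 2)) * ⟪ξ, h⟫) • dir ξ‖
      ≤ ‖(1 * g) • dirDeriv ξ h‖ + ‖(2 * (-(5 / 2) * 1 * g / (1 + ‖ξ‖ ^ 2)) * ⟪ξ, h⟫) • dir ξ‖ :=
        norm_add_le _ _
    _ = g * ‖dirDeriv ξ h‖ + 5 * g / (1 + ‖ξ‖ ^ 2) * |⟪ξ, h⟫| * ‖dir ξ‖ := by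
        rw [norm_smul, norm_smul, one_mul, Real.norm_eq_abs, abs_of_pos hg, Real.norm_eq_abs, abs_mul,
          show |2 * (-(5 / 2) * 1 * g / (1 + ‖ξ‖ ^ 2))| = 5 * g / (1 + ‖ξ‖ ^ 2) by
            rw [show 2 * (-(5 / 2) * 1 * g / (1 + ‖ξ‖ ^ 2)) = -(5 * g / (1 + ‖ξ‖ ^ 2)) by ring, abs_neg,
              abs_of_pos (by positivity)]]
    _ ≤ g * (4 * ‖ξ‖ * ‖h‖) + 5 * g / (1 + ‖ξ‖ ^ 2) * (‖ξ‖ * ‖h‖) * (2 * ‖ξ‖ ^ 2) := by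
        gcongr
        · exact norm_dirDeriv_le ξ h
        · exact norm_dir_le ξ
    _ = g * ‖ξ‖ * ‖h‖ * (4 + 10 * (‖ξ‖ ^ 2 / (1 + ‖ξ‖ ^ 2))) := by
        field_simp
        ring
    _ ≤ g * ‖ξ‖ * ‖h‖ * (4 + 10 * 1) := by gcongr
    _ = 14 * g * ‖ξ‖ * ‖h‖ := by ring

/-- `g² |ξ|² ≤ (1+|ξ|²)^{-4}` for the unit profile `g = (1+|ξ|²)^{-5/2}`. [folklore] -/
private theorem profile_one_sq_mul_le (ξ : ℝ³) :
    ((1 + ‖ξ‖ ^ 2) ^ (-(5 / 2 : ℝ))) ^ 2 * ‖ξ‖ ^ 2 ≤ (1 + ‖ξ‖ ^ 2) ^ (-(8 : ℝ) / 2) := by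
  have hs : 0 < 1 + ‖ξ‖ ^ 2 := by positivity
  have e1 : ((1 + ‖ξ‖ ^ 2) ^ (-(5 / 2 : ℝ))) ^ 2 = 1 ^ 2 / (1 + ‖ξ‖ ^ 2) ^ 5 := by
    rw [← profile_sq 1 hs.le, profile, one_mul]
  have e2 : (1 + ‖ξ‖ ^ 2) ^ (-(8 : ℝ) / 2) = ((1 + ‖ξ‖ ^ 2) ^ 4)⁻¹ := by
    rw [show (-(8 : ℝ) / 2) = -((4 : ℕ) : ℝ) by norm_num, Real.rpow_neg hs.le, Real.rpow_natCast]
  rw [e1, e2, one_pow, div_mul_eq_mul_div, one_mul, div_le_iff₀ (by positivity)]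
  rw [show ((1 + ‖ξ‖ ^ 2) ^ 4)⁻¹ * (1 + ‖ξ‖ ^ 2) ^ 5 = 1 + ‖ξ‖ ^ 2 by field_simp]
  linarith

/-- **Domination of the enstrophy density of the unit profile**:
`|∇V_{1,1}(ξ)|² ≤ 588 (1+|ξ|²)^{-4}`. [cite: GaldiGazzola2026, Lemma 3.1 (the radial integral), p. 8] -/
theorem frobeniusNormSq_fderiv_bubble_one_le (ξ : ℝ³) :
    frobeniusNormSq (fderiv ℝ (bubble 1 1) ξ) ≤ 588 * (1 + ‖ξ‖ ^ 2) ^ (-(8 : ℝ) / 2) := by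
  rw [frobeniusNormSq_eq_sum (EuclideanSpace.basisFun (Fin 3) ℝ)]
  have hterm : ∀ i : Fin 3, ‖fderiv ℝ (bubble 1 1) ξ (EuclideanSpace.basisFun (Fin 3) ℝ i)‖ ^ 2 ≤
      196 * (1 + ‖ξ‖ ^ 2) ^ (-(8 : ℝ) / 2) := fun i => by
    have h1 := norm_fderiv_bubble_one_le ξ (EuclideanSpace.basisFun (Fin 3) ℝ i)
    rw [EuclideanSpace.basisFun_apply, PiLp.norm_single, norm_one, mul_one] at h1
    rw [EuclideanSpace.basisFun_apply]
    have h0 : 0 ≤ ‖fderiv ℝ (bubble 1 1) ξ (EuclideanSpace.single i (1 : ℝ))‖ := norm_nonneg _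
    calc ‖fderiv ℝ (bubble 1 1) ξ (EuclideanSpace.single i (1 : ℝ))‖ ^ 2
        ≤ (14 * (1 + ‖ξ‖ ^ 2) ^ (-(5 / 2 : ℝ)) * ‖ξ‖) ^ 2 := pow_le_pow_left₀ h0 h1 2
      _ = 196 * (((1 + ‖ξ‖ ^ 2) ^ (-(5 / 2 : ℝ))) ^ 2 * ‖ξ‖ ^ 2) := by ring
      _ ≤ 196 * (1 + ‖ξ‖ ^ 2) ^ (-(8 : ℝ) / 2) :=
          mul_le_mul_of_nonneg_left (profile_one_sq_mul_le ξ) (by norm_num)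
  calc ∑ i, ‖fderiv ℝ (bubble 1 1) ξ (EuclideanSpace.basisFun (Fin 3) ℝ i)‖ ^ 2
      ≤ ∑ _i : Fin 3, 196 * (1 + ‖ξ‖ ^ 2) ^ (-(8 : ℝ) / 2) := Finset.sum_le_sum fun i _ => hterm i
    _ = 588 * (1 + ‖ξ‖ ^ 2) ^ (-(8 : ℝ) / 2) := by
        rw [Finset.sum_const, Finset.card_univ, Fintype.card_fin]
        ring

/-- The enstrophy density of the unit profile is continuous. [folklore] -/
private theorem continuous_frobeniusNormSq_fderiv_bubble_one :
    Continuous fun ξ : ℝ³ => frobeniusNormSq (fderiv ℝ (bubble 1 1) ξ) := by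
  have hc : Continuous (fderiv ℝ (bubble 1 1)) :=
    (contDiff_bubble one_pos 1 (n := 1)).continuous_fderiv one_ne_zero
  unfold frobeniusNormSq
  exact continuous_finsetSum _ fun i _ => ((hc.clm_apply continuous_const).norm).pow 2

/-- **The enstrophy of the unit profile is finite**: `|∇V_{1,1}|² ∈ L¹(ℝ³)` (decay `|ξ|^{-8}`).
[cite: GaldiGazzola2026, Lemma 3.1 (q > n/(p−k)) and Lemma 3.3, p. 8] -/
theorem integrable_frobeniusNormSq_fderiv_bubble_one :
    Integrable fun ξ : ℝ³ => frobeniusNormSq (fderiv ℝ (bubble 1 1) ξ) := by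
  have hdom : Integrable (fun ξ : ℝ³ => 588 * (1 + ‖ξ‖ ^ 2) ^ (-(8 : ℝ) / 2)) :=
    (integrable_rpow_neg_one_add_norm_sq (by rw [finrank_R3]; norm_num)).const_mul 588
  refine hdom.mono' continuous_frobeniusNormSq_fderiv_bubble_one.aestronglyMeasurable
    (Eventually.of_forall fun ξ => ?_)
  rw [Real.norm_eq_abs, abs_of_nonneg (frobeniusNormSq_nonneg _)]
  exact frobeniusNormSq_fderiv_bubble_one_le ξ

/-- **The enstrophy of the unit profile is positive**: `‖∇V_{1,1}‖₂² > 0` (e.g. `DV_{1,1}(e₂)e₁ = 2^{-5/2}(2,0,0) ≠ 0`).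
[cite: GaldiGazzola2026, Lemma 3.7 (proof) eq. (nablaV2) (the constant C > 0), p. 9] -/
theorem gradNormSq_bubble_one_pos : 0 < VectorCalculus.gradNormSq (bubble 1 1) := by
  unfold VectorCalculus.gradNormSq
  rw [integral_pos_iff_support_of_nonneg (fun ξ => frobeniusNormSq_nonneg _)
    integrable_frobeniusNormSq_fderiv_bubble_one]
  -- the density is positive at `e₂ = (0,0,1)`: `DV_{1,1}(e₂) e₁ = g(1) (2,0,0)`
  have hval : 0 < frobeniusNormSq (fderiv ℝ (bubble 1 1) (EuclideanSpace.single (2 : Fin 3) (1 : ℝ))) := by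
    rw [frobeniusNormSq_eq_sum (EuclideanSpace.basisFun (Fin 3) ℝ)]
    have h1 : 0 < ‖fderiv ℝ (bubble 1 1) (EuclideanSpace.single (2 : Fin 3) (1 : ℝ))
        (EuclideanSpace.basisFun (Fin 3) ℝ 1)‖ ^ 2 := by
      rw [EuclideanSpace.basisFun_apply, fderiv_bubble_apply one_pos]
      have e0 : ⟪(EuclideanSpace.single (2 : Fin 3) (1 : ℝ) : ℝ³), EuclideanSpace.single (1 : Fin 3) (1 : ℝ)⟫ = 0 := by
        simp [EuclideanSpace.inner_single_right]
      have hd : dirDeriv (EuclideanSpace.single (2 : Fin 3) (1 : ℝ)) (EuclideanSpace.single (1 : Fin 3) (1 : ℝ)) =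
          EuclideanSpace.single 0 (2 : ℝ) := by
        ext i
        fin_cases i <;> simp
      have hp : 0 < profile 1 1 (‖(EuclideanSpace.single (2 : Fin 3) (1 : ℝ) : ℝ³)‖ ^ 2) := by
        unfold profile
        positivity
      have h2 : 0 < ‖(EuclideanSpace.single (0 : Fin 3) (2 : ℝ) : ℝ³)‖ := by
        rw [PiLp.norm_single]
        norm_num
      rw [e0, mul_zero, zero_smul, add_zero, norm_smul, hd, Real.norm_eq_abs, abs_of_pos hp]
      exact pow_pos (mul_pos hp h2) 2
    refine lt_of_lt_of_le h1 ?_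
    exact Finset.single_le_sum (f := fun i => ‖fderiv ℝ (bubble 1 1) (EuclideanSpace.single (2 : Fin 3) (1 : ℝ))
      (EuclideanSpace.basisFun (Fin 3) ℝ i)‖ ^ 2) (fun i _ => sq_nonneg _) (Finset.mem_univ 1)
  have hopen : IsOpen (Function.support fun ξ : ℝ³ => frobeniusNormSq (fderiv ℝ (bubble 1 1) ξ)) :=
    continuous_frobeniusNormSq_fderiv_bubble_one.isOpen_support
  exact hopen.measure_pos volume ⟨_, hval.ne'⟩

/-! ### Lemma 3.7: the enstrophy blows up at `T` iff `4δ < 5γ` -/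

/-- `|T − t| → 0⁺` as `t → T`, `t ≠ T`. [folklore] -/
private theorem tendsto_abs_sub_nhdsGT (T : ℝ) :
    Tendsto (fun t => |T - t|) (𝓝[≠] T) (𝓝[>] 0) := by
  refine tendsto_nhdsWithin_iff.2 ⟨?_, ?_⟩
  · have hc : Continuous fun t : ℝ => |T - t| := (continuous_const.sub continuous_id).abs
    have := hc.tendsto T
    rw [sub_self, abs_zero] at this
    exact tendsto_nhdsWithin_of_tendsto_nhds this
  · filter_upwards [self_mem_nhdsWithin] with t ht
    exact abs_pos_of_ne ht

/-- `x^p → +∞` as `x → 0⁺` for `p < 0`. [folklore] -/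
private theorem tendsto_rpow_neg_nhdsGT_zero {p : ℝ} (hp : p < 0) :
    Tendsto (fun x : ℝ => x ^ p) (𝓝[>] 0) atTop := by
  have h1 : Tendsto (fun x : ℝ => (x⁻¹) ^ (-p)) (𝓝[>] 0) atTop :=
    (tendsto_rpow_atTop (by linarith)).comp tendsto_inv_nhdsGT_zero
  refine h1.congr' ?_
  filter_upwards [self_mem_nhdsWithin] with x hx
  rw [Real.inv_rpow (le_of_lt hx), Real.rpow_neg (le_of_lt hx), inv_inv]

/-- **Lemma 3.7 (blupenstrophy), "if" direction with the rate**: for `4δ < 5γ` the enstrophy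
`‖∇V(t)‖₂² = C|T−t|^{4δ−5γ}` (`C = ‖∇V_{1,1}‖₂² ∈ (0, ∞)`) tends to `+∞` as `t → T`.
[cite: GaldiGazzola2026, Lemma 3.7 eq. (blupenstrophy), p. 9] -/
theorem tendsto_gradNormSq_vortex_atTop {T δ γ : ℝ} (h : 4 * δ < 5 * γ) :
    Tendsto (fun t => VectorCalculus.gradNormSq (vortex T δ γ t)) (𝓝[≠] T) atTop := by
  have e : (fun t => |T - t| ^ (4 * δ - 5 * γ) * VectorCalculus.gradNormSq (bubble 1 1)) =ᶠ[𝓝[≠] T]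
      fun t => VectorCalculus.gradNormSq (vortex T δ γ t) := by
    filter_upwards [self_mem_nhdsWithin] with t ht
    rw [gradNormSq_vortex δ γ ht]
  refine Tendsto.congr' e ?_
  exact ((tendsto_rpow_neg_nhdsGT_zero (by linarith)).comp (tendsto_abs_sub_nhdsGT T)).atTop_mul_const
    gradNormSq_bubble_one_pos

/-- For `4δ ≥ 5γ` the enstrophy stays bounded near `T`: it tends to `C · 0^{4δ−5γ} ∈ {0, C}`.
[cite: GaldiGazzola2026, Lemma 3.7 eq. (blupenstrophy), p. 9] -/
theorem tendsto_gradNormSq_vortex_of_le {T δ γ : ℝ} (h : 5 * γ ≤ 4 * δ) :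
    Tendsto (fun t => VectorCalculus.gradNormSq (vortex T δ γ t)) (𝓝[≠] T)
      (𝓝 ((0 : ℝ) ^ (4 * δ - 5 * γ) * VectorCalculus.gradNormSq (bubble 1 1))) := by
  have e : (fun t => |T - t| ^ (4 * δ - 5 * γ) * VectorCalculus.gradNormSq (bubble 1 1)) =ᶠ[𝓝[≠] T]
      fun t => VectorCalculus.gradNormSq (vortex T δ γ t) := by
    filter_upwards [self_mem_nhdsWithin] with t ht
    rw [gradNormSq_vortex δ γ ht]
  refine Tendsto.congr' e ?_
  have hc : Continuous fun t : ℝ => |T - t| ^ (4 * δ - 5 * γ) * VectorCalculus.gradNormSq (bubble 1 1) :=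
    ((continuous_const.sub continuous_id).abs.rpow_const fun x => Or.inr (by linarith)).mul
      continuous_const
  have := hc.tendsto T
  rw [sub_self, abs_zero] at this
  exact tendsto_nhdsWithin_of_tendsto_nhds this

/-- **Lemma 3.7 (blupenstrophy)**: `‖∇V(t)‖_{L²} → ∞` as `t → T` **iff** `4δ < 5γ` (here with the
enstrophy `‖∇V(t)‖₂²` and `t → T`, `t ≠ T`, for the `|T−t|`-extended field).
[cite: GaldiGazzola2026, Lemma 3.7 eq. (blupenstrophy), p. 9] -/
theorem tendsto_gradNormSq_vortex_atTop_iff (T δ γ : ℝ) :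
    Tendsto (fun t => VectorCalculus.gradNormSq (vortex T δ γ t)) (𝓝[≠] T) atTop ↔ 4 * δ < 5 * γ := by
  refine ⟨fun h => ?_, tendsto_gradNormSq_vortex_atTop⟩
  by_contra hle
  exact not_tendsto_atTop_of_tendsto_nhds (tendsto_gradNormSq_vortex_of_le (not_lt.1 hle)) h


/-! ### Lemma 3.7 (blupL3): `‖V(t)‖₃ → ∞` iff `δ < γ` -/

/-- Domination of the cubed unit profile: `|V_{1,1}(ξ)|³ ≤ 8 (1+|ξ|²)^{-9/2}`.
[cite: GaldiGazzola2026, Lemma 3.1 (the radial integral) and eq. (VLqq), p. 8] -/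
theorem norm_bubble_one_cube_le (ξ : ℝ³) : ‖bubble 1 1 ξ‖ ^ 3 ≤ 8 * (1 + ‖ξ‖ ^ 2) ^ (-(9 : ℝ) / 2) := by
  have hs : 0 < 1 + ‖ξ‖ ^ 2 := by positivity
  set x := 1 + ‖ξ‖ ^ 2 with hx
  have hg : 0 ≤ x ^ (-(5 / 2 : ℝ)) := Real.rpow_nonneg hs.le _
  -- `g σ ≤ g x = x^{-3/2}`
  have h1 : x ^ (-(5 / 2 : ℝ)) * ‖ξ‖ ^ 2 ≤ x ^ (-(3 / 2 : ℝ)) := by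
    calc x ^ (-(5 / 2 : ℝ)) * ‖ξ‖ ^ 2 ≤ x ^ (-(5 / 2 : ℝ)) * x :=
          mul_le_mul_of_nonneg_left (by rw [hx]; linarith) hg
      _ = x ^ (-(3 / 2 : ℝ)) := by
          rw [← Real.rpow_add_one hs.ne']
          norm_num
  have h2 : ‖bubble 1 1 ξ‖ ≤ 2 * (x ^ (-(5 / 2 : ℝ)) * ‖ξ‖ ^ 2) := by
    have := norm_bubble_one_le ξ
    rw [← hx] at this
    linarith
  have h3 : (x ^ (-(3 / 2 : ℝ))) ^ 3 = x ^ (-(9 : ℝ) / 2) := by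
    rw [← Real.rpow_natCast, ← Real.rpow_mul hs.le]
    norm_num
  calc ‖bubble 1 1 ξ‖ ^ 3 ≤ (2 * (x ^ (-(5 / 2 : ℝ)) * ‖ξ‖ ^ 2)) ^ 3 := pow_le_pow_left₀ (norm_nonneg _) h2 3
    _ = 8 * (x ^ (-(5 / 2 : ℝ)) * ‖ξ‖ ^ 2) ^ 3 := by ring
    _ ≤ 8 * (x ^ (-(3 / 2 : ℝ))) ^ 3 := by gcongr
    _ = 8 * (1 + ‖ξ‖ ^ 2) ^ (-(9 : ℝ) / 2) := by rw [h3]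

/-- **The `L³`-mass of the unit profile is finite**: `|V_{1,1}|³ ∈ L¹(ℝ³)` (decay `|ξ|^{-9}`).
[cite: GaldiGazzola2026, eq. (VLqq) (q > 1), p. 8] -/
theorem integrable_norm_bubble_one_cube : Integrable fun ξ : ℝ³ => ‖bubble 1 1 ξ‖ ^ 3 := by
  have hdom : Integrable (fun ξ : ℝ³ => 8 * (1 + ‖ξ‖ ^ 2) ^ (-(9 : ℝ) / 2)) :=
    (integrable_rpow_neg_one_add_norm_sq (by rw [finrank_R3]; norm_num)).const_mul 8
  refine hdom.mono' (((contDiff_bubble one_pos 1 (n := 0)).continuous.norm).pow 3).aestronglyMeasurable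
    (Eventually.of_forall fun ξ => ?_)
  rw [Real.norm_eq_abs, abs_of_nonneg (by positivity)]
  exact norm_bubble_one_cube_le ξ

/-- **The `L³`-mass of the unit profile is positive** (`V_{1,1}(e₁ + e₂) = 3^{-5/2}(2,0,0) ≠ 0`).
[cite: GaldiGazzola2026, Lemma 3.7 (proof: ‖V(t)‖₃³ = C(T−t)^{6δ−6γ}, C > 0), p. 9] -/
theorem integral_norm_bubble_one_cube_pos : 0 < ∫ ξ : ℝ³, ‖bubble 1 1 ξ‖ ^ 3 := by
  rw [integral_pos_iff_support_of_nonneg (fun ξ => by positivity) integrable_norm_bubble_one_cube]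
  have hval : 0 < ‖bubble 1 1 (EuclideanSpace.single (1 : Fin 3) (1 : ℝ) + EuclideanSpace.single 2 1)‖ ^ 3 := by
    have hd : dir (EuclideanSpace.single (1 : Fin 3) (1 : ℝ) + EuclideanSpace.single 2 1) =
        EuclideanSpace.single 0 (2 : ℝ) := by
      ext i
      fin_cases i <;> simp
    have hp : 0 < profile 1 1 (‖(EuclideanSpace.single (1 : Fin 3) (1 : ℝ) + EuclideanSpace.single 2 1 : ℝ³)‖ ^ 2) := by
      unfold profile
      positivity
    have h2 : 0 < ‖(EuclideanSpace.single (0 : Fin 3) (2 : ℝ) : ℝ³)‖ := by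
      rw [PiLp.norm_single]
      norm_num
    rw [bubble, hd, norm_smul, Real.norm_eq_abs, abs_of_pos hp]
    exact pow_pos (mul_pos hp h2) 3
  have hopen : IsOpen (Function.support fun ξ : ℝ³ => ‖bubble 1 1 ξ‖ ^ 3) :=
    (((contDiff_bubble one_pos 1 (n := 0)).continuous.norm).pow 3).isOpen_support
  exact hopen.measure_pos volume ⟨_, hval.ne'⟩

/-- **Lemma 3.7 (blupL3), "if" direction with the rate**: for `δ < γ`,
`‖V(t)‖₃³ = C|T−t|^{6δ−6γ} → +∞` as `t → T` (`C = ‖V_{1,1}‖₃³ ∈ (0, ∞)`).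
[cite: GaldiGazzola2026, Lemma 3.7 eq. (blupL3), p. 9] -/
theorem tendsto_integral_norm_cube_vortex_atTop {T δ γ : ℝ} (h : δ < γ) :
    Tendsto (fun t => ∫ ξ, ‖vortex T δ γ t ξ‖ ^ 3) (𝓝[≠] T) atTop := by
  have e : (fun t => |T - t| ^ (6 * δ - 6 * γ) * ∫ ξ, ‖bubble 1 1 ξ‖ ^ 3) =ᶠ[𝓝[≠] T]
      fun t => ∫ ξ, ‖vortex T δ γ t ξ‖ ^ 3 := by
    filter_upwards [self_mem_nhdsWithin] with t ht
    rw [integral_norm_cube_vortex δ γ ht]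
  refine Tendsto.congr' e ?_
  exact ((tendsto_rpow_neg_nhdsGT_zero (by linarith)).comp (tendsto_abs_sub_nhdsGT T)).atTop_mul_const
    integral_norm_bubble_one_cube_pos

/-- For `δ ≥ γ` the `L³`-mass stays bounded near `T` (tends to `C · 0^{6δ−6γ}`).
[cite: GaldiGazzola2026, Lemma 3.7 eq. (blupL3), p. 9] -/
theorem tendsto_integral_norm_cube_vortex_of_le {T δ γ : ℝ} (h : γ ≤ δ) :
    Tendsto (fun t => ∫ ξ, ‖vortex T δ γ t ξ‖ ^ 3) (𝓝[≠] T)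
      (𝓝 ((0 : ℝ) ^ (6 * δ - 6 * γ) * ∫ ξ, ‖bubble 1 1 ξ‖ ^ 3)) := by
  have e : (fun t => |T - t| ^ (6 * δ - 6 * γ) * ∫ ξ, ‖bubble 1 1 ξ‖ ^ 3) =ᶠ[𝓝[≠] T]
      fun t => ∫ ξ, ‖vortex T δ γ t ξ‖ ^ 3 := by
    filter_upwards [self_mem_nhdsWithin] with t ht
    rw [integral_norm_cube_vortex δ γ ht]
  refine Tendsto.congr' e ?_
  have hc : Continuous fun t : ℝ => |T - t| ^ (6 * δ - 6 * γ) * ∫ ξ, ‖bubble 1 1 ξ‖ ^ 3 :=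
    ((continuous_const.sub continuous_id).abs.rpow_const fun x => Or.inr (by linarith)).mul
      continuous_const
  have := hc.tendsto T
  rw [sub_self, abs_zero] at this
  exact tendsto_nhdsWithin_of_tendsto_nhds this

/-- **Lemma 3.7 (blupL3)**: `‖V(t)‖_{L³} → ∞` as `t → T` **iff** `δ < γ` (stated for `‖V(t)‖₃³`,
`t → T` with `t ≠ T`, `|T−t|`-extended field). [cite: GaldiGazzola2026, Lemma 3.7 eq. (blupL3), p. 9] -/
theorem tendsto_integral_norm_cube_vortex_atTop_iff (T δ γ : ℝ) :
    Tendsto (fun t => ∫ ξ, ‖vortex T δ γ t ξ‖ ^ 3) (𝓝[≠] T) atTop ↔ δ < γ := by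
  refine ⟨fun h => ?_, tendsto_integral_norm_cube_vortex_atTop⟩
  by_contra hle
  exact not_tendsto_atTop_of_tendsto_nhds (tendsto_integral_norm_cube_vortex_of_le (not_lt.1 hle)) h

end GaldiGazzola

end Literature.Analysis.FluidPDE
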